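import Summits.QuantumFields.YangMills.Theorems.BalabanUVNodesN18KernelStepRateBoxes
import Literature.MathematicalPhysics.QuantumFieldTheory.Balaban1983to89.Node00.U3KernelLetters

/-!
# BalabanUVNodes ∕ N18 — NODE N18 AT THE READING OF RECORD BY NAME OF THE DEFINERS' KERNEL-INPUT LETTERS (node00-def-W1's W1-19b `Node00/U3KernelLetters`):
# the N18 slot at the kernel objects of record IS `KernelStepRateOfRecord₁₃` (`Iff`), and is PRODUCED from `PolLimitsExistBoxOfRecord₁₃` (⇐ `PolLimitsExistOfRecord₁₃`)
# + `WindowedStepRateOfRecord₁₃` — generic, at the record, and under the K3⁷ v3 reading pin `U3PinnedKernels`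
# (Track A, DAG node N18 = NE5; cluster K4 «SpineRates»; key K3⁷ `SpineGivenEndpointR13SepCoPH`, skeleton v3 02f6f498332fdbee)

HONEST FRAMING.  Count-neutral kernel bookkeeping (seat `pub-ymgap-dag-n18-w1` g2; `--supports stmt-QuantumFields-20544`, helper lane), LOCATED: the letters
`KernelStepRate(OfRecord₁₃)` (the η-rate of consecutive-level LIMITING (1.21) kernels), `WindowedStepRate(OfRecord₁₃)` (its finite-volume two-run form) and
`PolLimitsExist(Box)(OfRecord₁₃)` ((1.21) «This limit exists») are DISPLAY LETTERS of W1-19b — hypotheses on Bałaban's merged term (1.6), asserted for nothing;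
this file only identifies the N18 slot with the first and produces it from the other two BY NAME (the passage `le_of_tendsto` is this seat's
`…N18KernelStepRateBoxes` §2b).  Nothing of Bałaban's is asserted; NE5 NOT PRINTED ∕ NOT proved; N18 NOT discharged; K3⁷ OPEN, not claimed; counts unmoved.
One finite four-torus programme at fixed ε — R4 closes the conditional rung `BalabanLadder.UV` only; nothing continuum ∕ ℝ⁴ ∕ OS ∕ mass gap ∕ Clay.
THEOREMS ONLY: 0 `def`, 0 `sorry`, standard axioms.

WHAT.
* §1 generic term family `ℰ`: `n18At_u3OfRecord₁₃_objects_iff_kernelStepRate_letter` (`N18At (u3OfRecord₁₃ θ (objects F ℰ ρ bV ℓ) k) ↔ KernelStepRate F ℰ ρ bV θ.γ ℓ.κ ℓ.θ₅ ℓ.C₅`) ·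
  ★ `kernelStepRate_of_windowed` (`PolLimitsExistBox F ℰ ρ bV γ → WindowedStepRate F ℰ ρ bV γ s κ θ (C₅ * θ) → KernelStepRate F ℰ ρ bV γ κ θ C₅` — the N18 LETTER
  PRODUCED from the finite-volume letters; `…_of_windowed'` from the WINDOW form `PolLimitsExist … (Window γ)`).
* §2 at the record: `n18At_u3OfRecord₁₃_objectsOfRecord₁₃_iff_kernelStepRateOfRecord₁₃` · ★ `kernelStepRateOfRecord₁₃_of_windowed` (`PolLimitsExistBoxOfRecord₁₃ F N θ →
  WindowedStepRateOfRecord₁₃ F N θ s κ θ₅ (C₅ * θ₅) → KernelStepRateOfRecord₁₃ F N θ κ θ₅ C₅`) · `n18At_u3OfRecord₁₃_objectsOfRecord₁₃_of_letters`.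
* §3 under the reading pin `hpin : (𝔯.lit F θ hP g₀ os).u3 = objectsOfRecord₁₃ F N θ.toStage13Params ℓ` (= K3⁷ v3 `U3PinnedKernels 𝔯 ℓ'` at the tuple with `ℓ := ℓ' F θ`):
  ★★ `n18At_rateCarriers_of_kernels_pin_iff_letter` · ★★ `n18At_rateCarriers_of_kernels_pin_of_letters` — the N18 conjunct of v3's `KeyedRatesHolderD4` at ANY run
  length from `PolLimitsExistBoxOfRecord₁₃` + `WindowedStepRateOfRecord₁₃ … s ℓ.κ ℓ.θ₅ (ℓ.C₅ * ℓ.θ₅)` (the shape a v3.x §2b sanity `n18At_rrOfRecord_of_pinned` would cite,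
  parallel to n22-w3's `n22At_rateCarriers_of_kernels_pin_of_ne9`).

Sources (types only): T. Bałaban, CMP **109** (1987) [Balaban1987RG1] Thm 1 p. 259, (1.20)–(1.22) p. 264, (1.6) p. 261.  Nothing here is a claim about the
Yang–Mills mass gap.
-/

noncomputable section

namespace YMDAG.N18.AtRecordOfKernelLetters

open scoped BigOperators
open Literature.MathematicalPhysics.QuantumFieldTheory.Balaban1983to89
open Literature.MathematicalPhysics.QuantumFieldTheory.Balaban1983to89.T4Continuum (T4Family ULoop)
open Literature.MathematicalPhysics.QuantumFieldTheory.Balaban1983to89.T4OutputRate (Window NE5)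
open Node00 (U3Letters₁₁ Stage13Params Stage13HParams TermFamily1)
open Node00.U3OfKernels (objects objectsOfRecord₁₃)
open Node00.U3KernelLetters (KernelStepRate PolLimitsExist PolLimitsExistBox WindowedStepRate KernelStepRateOfRecord₁₃ PolLimitsExistOfRecord₁₃
  PolLimitsExistBoxOfRecord₁₃ WindowedStepRateOfRecord₁₃ kernelStepRate_iff_forall_ne5)
open YMDAG.N18.KernelStepRateBoxes (decay510_subKernel_of_finiteVolume ne5_family_of_decay510_subKernel)
open YMDAG.UVSplit

/-! ## §1 Generic term family: the N18 slot IS the letter `KernelStepRate`; the letter from the finite-volume letters -/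

section Generic

variable {𝔄 : Type*} [NormedRing 𝔄] [NormedAlgebra ℝ 𝔄]
variable {V : Type*} [NormedAddCommGroup V] [NormedSpace ℝ V] {ι : Type*} [Fintype ι]
variable (F : T4Family) (ℰ : TermFamily1 F 𝔄) (ρ : V →L[ℝ] 𝔄) (bV : Module.Basis ι ℝ V)
variable {N : ℕ} [NeZero N]

/-- **THE N18 SLOT AT THE KERNEL OBJECTS IS THE LETTER `KernelStepRate`** at the record's window radius and the letter block's `(κ, θ₅, C₅)` (any index `k`).
[cite: Balaban1987RG1, Thm 1 p.259 and (1.21) p.264] -/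
theorem n18At_u3OfRecord₁₃_objects_iff_kernelStepRate_letter (θ : Stage13Params F N) (ℓ : U3Letters₁₁) (k : ℕ) :
    N18At (u3OfRecord₁₃ θ (objects F ℰ ρ bV ℓ) k) ↔ KernelStepRate F ℰ ρ bV θ.γ ℓ.κ ℓ.θ₅ ℓ.C₅ := by
  show (∀ b : ℝ, 0 < b → b ≤ θ.γ →
      NE5 (Node00.U3OfKernels.EA F ℰ ρ bV) (Node00.U3OfKernels.EB F ℰ ρ bV b) (Window θ.γ) ℓ.κ ℓ.θ₅ ℓ.C₅) ↔ _
  exact (kernelStepRate_iff_forall_ne5 F ℰ ρ bV θ.γ ℓ.κ ℓ.θ₅ ℓ.C₅).symm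

variable {ℰ} in
/-- ★ **THE N18 LETTER PRODUCED FROM THE FINITE-VOLUME LETTERS** (box form of the (1.21) existence): `PolLimitsExistBox F ℰ ρ bV γ` and
`WindowedStepRate F ℰ ρ bV γ s κ θ (C₅·θ)` (the runs `s` approximations apart) give `KernelStepRate F ℰ ρ bV γ κ θ C₅` — the boxed rate passes to the
limiting kernels (`…KernelStepRateBoxes.decay510_subKernel_of_finiteVolume`) and re-indexes to the family (`…ne5_family_of_decay510_subKernel`).
[cite: Balaban1987RG1, (1.20)–(1.21) p.264 and Thm 1 p.259] -/
theorem kernelStepRate_of_windowed {γ κ θ C₅ : ℝ} (s : ℕ) (hex : PolLimitsExistBox F ℰ ρ bV γ)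
    (hfin : WindowedStepRate F ℰ ρ bV γ s κ θ (C₅ * θ)) : KernelStepRate F ℰ ρ bV γ κ θ C₅ :=
  (kernelStepRate_iff_forall_ne5 F ℰ ρ bV γ κ θ C₅).2
    (ne5_family_of_decay510_subKernel F ℰ ρ bV (decay510_subKernel_of_finiteVolume F ℰ ρ bV s hex hfin))

variable {ℰ} in
/-- The same from the WINDOW form of the existence letter (`PolLimitsExist … (Window γ)`, W1-19b's `PolLimitsExist.box`).
[cite: Balaban1987RG1, (1.21) p.264] -/
theorem kernelStepRate_of_windowed' {γ κ θ C₅ : ℝ} (s : ℕ) (hex : PolLimitsExist F ℰ ρ bV (Window γ))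
    (hfin : WindowedStepRate F ℰ ρ bV γ s κ θ (C₅ * θ)) : KernelStepRate F ℰ ρ bV γ κ θ C₅ :=
  kernelStepRate_of_windowed F ρ bV s hex.box hfin

/-- N18 at the ₁₃ bundle of the kernel objects from the two finite-volume letters (any index `k`). [cite: Balaban1987RG1, (1.20)–(1.21) p.264] -/
theorem n18At_u3OfRecord₁₃_objects_of_letters (θ : Stage13Params F N) (ℓ : U3Letters₁₁) (k s : ℕ)
    (hex : PolLimitsExistBox F ℰ ρ bV θ.γ) (hfin : WindowedStepRate F ℰ ρ bV θ.γ s ℓ.κ ℓ.θ₅ (ℓ.C₅ * ℓ.θ₅)) :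
    N18At (u3OfRecord₁₃ θ (objects F ℰ ρ bV ℓ) k) :=
  (n18At_u3OfRecord₁₃_objects_iff_kernelStepRate_letter F ℰ ρ bV θ ℓ k).2 (kernelStepRate_of_windowed F ρ bV s hex hfin)

end Generic

/-! ## §2 At the record, Stage 13: the letters OF RECORD (`…OfRecord₁₃`, the merged term family of record in the record's β-chart) -/

section Record

open scoped Matrix.Norms.L2Operator

variable (F : T4Family) (N : ℕ) [NeZero N]

/-- **THE N18 SLOT AT THE OBJECTS OF RECORD IS `KernelStepRateOfRecord₁₃ F N θ ℓ.κ ℓ.θ₅ ℓ.C₅`** (any index `k`). [cite: Balaban1987RG1, Thm 1 p.259 and (1.21) p.264] -/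
theorem n18At_u3OfRecord₁₃_objectsOfRecord₁₃_iff_kernelStepRateOfRecord₁₃ (θ : Stage13Params F N) (ℓ : U3Letters₁₁) (k : ℕ) :
    N18At (u3OfRecord₁₃ θ (objectsOfRecord₁₃ F N θ ℓ) k) ↔ KernelStepRateOfRecord₁₃ F N θ ℓ.κ ℓ.θ₅ ℓ.C₅ := by
  letI := θ.instVβ₁; letI := θ.instVβ₂; letI := θ.instιβ
  exact n18At_u3OfRecord₁₃_objects_iff_kernelStepRate_letter F _ θ.ρ8 θ.bV θ ℓ k

/-- ★ **THE N18 LETTER OF RECORD PRODUCED FROM THE FINITE-VOLUME LETTERS OF RECORD**: `PolLimitsExistBoxOfRecord₁₃ F N θ` and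
`WindowedStepRateOfRecord₁₃ F N θ s κ θ₅ (C₅·θ₅)` give `KernelStepRateOfRecord₁₃ F N θ κ θ₅ C₅`. [cite: Balaban1987RG1, (1.20)–(1.21) p.264 and Thm 1 p.259] -/
theorem kernelStepRateOfRecord₁₃_of_windowed (θ : Stage13Params F N) {κ θ₅ C₅ : ℝ} (s : ℕ) (hex : PolLimitsExistBoxOfRecord₁₃ F N θ)
    (hfin : WindowedStepRateOfRecord₁₃ F N θ s κ θ₅ (C₅ * θ₅)) : KernelStepRateOfRecord₁₃ F N θ κ θ₅ C₅ := by
  letI := θ.instVβ₁; letI := θ.instVβ₂; letI := θ.instιβ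
  exact kernelStepRate_of_windowed F θ.ρ8 θ.bV s hex hfin

/-- The same from the WINDOW-form existence letter of record `PolLimitsExistOfRecord₁₃` (W1-19b's `.box`). [cite: Balaban1987RG1, (1.21) p.264] -/
theorem kernelStepRateOfRecord₁₃_of_windowed' (θ : Stage13Params F N) {κ θ₅ C₅ : ℝ} (s : ℕ) (hex : PolLimitsExistOfRecord₁₃ F N θ)
    (hfin : WindowedStepRateOfRecord₁₃ F N θ s κ θ₅ (C₅ * θ₅)) : KernelStepRateOfRecord₁₃ F N θ κ θ₅ C₅ :=
  kernelStepRateOfRecord₁₃_of_windowed F N θ s hex.box hfin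

/-- N18 at the ₁₃ bundle of the objects of record from the letter of record. [cite: Balaban1987RG1, Thm 1 p.259] -/
theorem n18At_u3OfRecord₁₃_objectsOfRecord₁₃_of_kernelStepRateOfRecord₁₃ (θ : Stage13Params F N) (ℓ : U3Letters₁₁) (k : ℕ)
    (h : KernelStepRateOfRecord₁₃ F N θ ℓ.κ ℓ.θ₅ ℓ.C₅) : N18At (u3OfRecord₁₃ θ (objectsOfRecord₁₃ F N θ ℓ) k) :=
  (n18At_u3OfRecord₁₃_objectsOfRecord₁₃_iff_kernelStepRateOfRecord₁₃ F N θ ℓ k).2 h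

/-- N18 at the ₁₃ bundle of the objects of record from the two finite-volume letters of record. [cite: Balaban1987RG1, (1.20)–(1.21) p.264] -/
theorem n18At_u3OfRecord₁₃_objectsOfRecord₁₃_of_letters (θ : Stage13Params F N) (ℓ : U3Letters₁₁) (k s : ℕ)
    (hex : PolLimitsExistBoxOfRecord₁₃ F N θ) (hfin : WindowedStepRateOfRecord₁₃ F N θ s ℓ.κ ℓ.θ₅ (ℓ.C₅ * ℓ.θ₅)) :
    N18At (u3OfRecord₁₃ θ (objectsOfRecord₁₃ F N θ ℓ) k) :=
  n18At_u3OfRecord₁₃_objectsOfRecord₁₃_of_kernelStepRateOfRecord₁₃ F N θ ℓ k (kernelStepRateOfRecord₁₃_of_windowed F N θ s hex hfin)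

/-! ## §3 Under the reading pin (K3⁷ v3 `U3PinnedKernels 𝔯 ℓ'` at the tuple, `ℓ := ℓ' F θ`) -/

variable {N}

/-- ★★ **THE N18 CONJUNCT OF A PINNED READING IS THE LETTER OF RECORD**: under `hpin`, at EVERY run-length bundle,
`N18At (rateCarriersOfRecord₁₃CoPH 𝔯 F θ hP g₀ os k).u3 ↔ KernelStepRateOfRecord₁₃ F N θ.toStage13Params ℓ.κ ℓ.θ₅ ℓ.C₅`. [cite: Balaban1987RG1, Thm 1 p.259 and (1.21) p.264] -/
theorem n18At_rateCarriers_of_kernels_pin_iff_letter (𝔯 : RateReading₁₃CoPH N) (θ : Stage13HParams F N)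
    (hP : θ.Provisos₁₃CoPH F N) (g₀ : ℕ → ℝ) (os : List (ULoop F)) (ℓ : U3Letters₁₁)
    (hpin : (𝔯.lit F θ hP g₀ os).u3 = objectsOfRecord₁₃ F N θ.toStage13Params ℓ) (k : ℕ) :
    N18At (rateCarriersOfRecord₁₃CoPH 𝔯 F θ hP g₀ os k).u3 ↔ KernelStepRateOfRecord₁₃ F N θ.toStage13Params ℓ.κ ℓ.θ₅ ℓ.C₅ := by
  show N18At (u3OfRecord₁₃ θ.toStage13Params (𝔯.lit F θ hP g₀ os).u3 k) ↔ _
  rw [hpin]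
  exact n18At_u3OfRecord₁₃_objectsOfRecord₁₃_iff_kernelStepRateOfRecord₁₃ F N θ.toStage13Params ℓ k

/-- ★★ **THE N18 CONJUNCT OF A PINNED READING FROM THE FINITE-VOLUME LETTERS OF RECORD** (the producer shape a K3⁷ v3.x §2b sanity would cite): under `hpin`,
`PolLimitsExistBoxOfRecord₁₃` and `WindowedStepRateOfRecord₁₃ … s ℓ.κ ℓ.θ₅ (ℓ.C₅·ℓ.θ₅)` give the N18 conjunct at EVERY run-length bundle — in particular at the
selected one of `KeyedRatesHolderD4`. [cite: Balaban1987RG1, (1.20)–(1.21) p.264 and Thm 1 p.259] -/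
theorem n18At_rateCarriers_of_kernels_pin_of_letters (𝔯 : RateReading₁₃CoPH N) (θ : Stage13HParams F N)
    (hP : θ.Provisos₁₃CoPH F N) (g₀ : ℕ → ℝ) (os : List (ULoop F)) (ℓ : U3Letters₁₁)
    (hpin : (𝔯.lit F θ hP g₀ os).u3 = objectsOfRecord₁₃ F N θ.toStage13Params ℓ) (k s : ℕ)
    (hex : PolLimitsExistBoxOfRecord₁₃ F N θ.toStage13Params)
    (hfin : WindowedStepRateOfRecord₁₃ F N θ.toStage13Params s ℓ.κ ℓ.θ₅ (ℓ.C₅ * ℓ.θ₅)) :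
    N18At (rateCarriersOfRecord₁₃CoPH 𝔯 F θ hP g₀ os k).u3 :=
  (n18At_rateCarriers_of_kernels_pin_iff_letter F 𝔯 θ hP g₀ os ℓ hpin k).2
    (kernelStepRateOfRecord₁₃_of_windowed F N θ.toStage13Params s hex hfin)

/-- The same from the letter of record directly (the K4 row N18 «as a letter» under the pin). [cite: Balaban1987RG1, Thm 1 p.259] -/
theorem n18At_rateCarriers_of_kernels_pin_of_kernelStepRateOfRecord₁₃ (𝔯 : RateReading₁₃CoPH N) (θ : Stage13HParams F N)
    (hP : θ.Provisos₁₃CoPH F N) (g₀ : ℕ → ℝ) (os : List (ULoop F)) (ℓ : U3Letters₁₁)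
    (hpin : (𝔯.lit F θ hP g₀ os).u3 = objectsOfRecord₁₃ F N θ.toStage13Params ℓ) (k : ℕ)
    (h : KernelStepRateOfRecord₁₃ F N θ.toStage13Params ℓ.κ ℓ.θ₅ ℓ.C₅) :
    N18At (rateCarriersOfRecord₁₃CoPH 𝔯 F θ hP g₀ os k).u3 :=
  (n18At_rateCarriers_of_kernels_pin_iff_letter F 𝔯 θ hP g₀ os ℓ hpin k).2 h

end Record

end YMDAG.N18.AtRecordOfKernelLetters

end
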